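import Literature.Analysis.Pluripotential.Plurisubharmonic
import Literature.AlgebraicGeometry.HodgeTheory.BiextensionHeightPackage
import Literature.Geometry.Kaehler.AnalyticSet
import HarnessLib

/-!
# Closed positive `(1,1)`-currents on `ℙᴺ(ℂ)`: degree, Lelong numbers, non-pluripolar Monge–Ampère masses

Topic `Literature/Analysis/Pluripotential`; answers the definition request
`defn-NonPluripolarMongeAmpereMass` of route `HodgeConjecture/HeightMassDefect` (items (2)–(4):
closed positive `(1,1)`-currents `T` on `ℙᴺ`, `deg T`, Lelong numbers `ν(T, x)` and generic Lelong
numbers `ν(T, Z)`, the non-pluripolar Monge–Ampère masses `∫ ⟨T^j⟩ ∧ ω^{N-j}` of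
Boucksom–Eyssidieux–Guedj–Zeriahi with `0 ≤ M_j ≤ (deg T)^j`, full mass, "full mass ⟹ zero
Lelong numbers"). Builds on `Plurisubharmonic.lean` (psh functions, Lelong numbers) and REUSES the
chart calculus of the sibling notion `Literature.AlgebraicGeometry.HodgeTheory.BiextensionHeight`
(`leviMatrix`, `fsPotential`, `heightDensity`, `chartVec`: densities of `(dd^c g)^j ∧ ω_FS^{N-j}`
in the affine chart `{z₀ ≠ 0}`, `dd^c = (i/π) ∂∂̄`, `∫_{ℙᴺ} ω_FS^N = 1`).

## The objects (REAL definitions)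

* `ClosedPositiveOneOneCurrent N` — a closed positive `(1,1)`-current `T` on `ℙᴺ(ℂ)`, PRESENTED
  BY ITS CONE POTENTIAL: pulling back along `π : ℂ^{N+1} ∖ {0} → ℙᴺ`, `π^* T = dd^c V` for a
  plurisubharmonic `V` on `ℂ^{N+1} ∖ {0}` which is logarithmically homogeneous,
  `V(a v) = V(v) + c log |a|` (`a ∈ ℂˣ`), where `c = deg T ≥ 0` is the degree
  (`{T} = c {ω_FS}`, `ω_FS = dd^c log ‖z‖`); `V` is unique up to an additive constant and every
  such `V ≢ -∞` arises (the classical dictionary "`PSH(ℙᴺ, c ω_FS)` = Lelong class of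
  `c`-log-homogeneous psh functions on `ℂ^{N+1}`", e.g. `V = c log ‖z‖` for `T = c ω_FS`, or
  `V = (c/d) log |F|` for the current of integration `(c/d) [F = 0]`, `F` homogeneous of degree
  `d`; the same presentation is used by `BiextensionHeightPackage.pot`). The structure carries `pot = V`
  (values in `EReal`, `-∞` allowed), `degree = c` and exactly these properties; different
  potentials of the same current differ by a real constant, which none of the derived quantities
  below sees. [folklore]
* `T.lelongNumber x = ν(V, v)` for any `v ≠ 0` over `x` (computed at `x.rep`; independent of `v`
  by homogeneity, and equal to the Lelong number of the local potential of `T` at `x` since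
  `V = φ ∘ (chart) + c log |z_i|` near `v` with the last term pluriharmonic);
  `T.genericLelongNumber Z = inf_{x ∈ Z} ν(T, x)` (Siu: the generic = minimal value along an
  irreducible analytic `Z`; Demailly 1992, §1: `ν_{p,k} = min_{x ∈ Z_{p,k}} ν(T, x)`);
  `T.lelongUpperLevelSet c = E_c(T) = {ν(T, ·) ≥ c}`.
* Examples: `ClosedPositiveOneOneCurrent.zero` and, in every degree `c ≥ 0`,
  `ClosedPositiveOneOneCurrent.logSupNorm N c` = `c · dd^c log ‖z‖_∞`, whose plurisubharmonicity
  is PROVED here (`isPlurisubharmonicOn_mul_log_norm`, via Jensen's inequality for affine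
  functions `mul_log_norm_affine_le_circleAverage` — Mathlib's circle-average formula for
  `log ‖· - a‖` — and the bridge `circleMean_coe_eq_circleAverage` between the `EReal` circle
  mean of `Plurisubharmonic.lean` and `Real.circleAverage`); their Lelong numbers vanish
  identically (`lelongNumber_logSupNorm`, from `lelongNumber_eq_zero_of_continuousAt`).
* `T.regularLocus` — the points `w` of the chart `ℂᴺ = {z₀ ≠ 0}` at which the chart potential
  `g = V(1, ·)` is `C²`; `T.regularMass j = ∫_{Reg(T)} (dd^c g)^j ∧ ω_FS^{N-j} ∈ [0, ∞]`, the
  Lebesgue integral of the (pointwise, classical) density. This is the HONEST, always-defined part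
  of the non-pluripolar mass: on the open set `Reg(T)` the non-pluripolar product `⟨T^j⟩` is the
  classical form `(dd^c g)^j` (plurifine locality, BEGZ Def. 1.1/Prop. 1.4, and Bedford–Taylor =
  pointwise for `C²` potentials), so `regularMass j ≤ ∫ ⟨T^j⟩ ∧ ω^{N-j}`, with EQUALITY when `V`
  is `C²` off a closed complete pluripolar set `A` (`T.IsRegularOff A`; BEGZ Def. 1.2 and §1.2:
  currents with *small unbounded locus*, `⟨T^j⟩` = trivial extension of the Bedford–Taylor product
  from `ℙᴺ ∖ A`) — the case of the route (`A` = dual variety, `V` smooth off it) and of currents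
  with analytic singularities. In general `regularMass` is only a lower bound (e.g. `V` continuous,
  nowhere `C²`: `Reg = ∅`).

## The general notion (HYPOTHESIS STRUCTURE, named-fact fields — allowed by the request)

The non-pluripolar product `⟨T^j⟩` of BEGZ (increasing limit of Bedford–Taylor products of the
truncations `max(φ, -k)` on the plurifine open sets `{φ > -k}`, BEGZ Def. 1.1, Prop. 1.6) needs
Bedford–Taylor theory (currents, induction `dd^c u ∧ S := dd^c(u S)`), which neither Mathlib nor
the tree has. `NonPluripolarMongeAmpereMass T` therefore records the total masses
`mass j = ∫_{ℙᴺ} ⟨T^j⟩ ∧ ω_FS^{N-j}` (`1 ≤ j ≤ N`) as DATA constrained by the printed theorems as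
fields: `regularMass j ≤ mass j` (locality, above), `mass j ≤ (deg T)^j` (BEGZ Prop. 1.20 with
`⟨α^j⟩ = α^j` for the Kähler class `α = c{ω}`), `mass j = regularMass j` under `IsRegularOff`
(BEGZ §1.2), full mass in top degree ⟹ full mass in every degree (BEGZ Cor. 2.15 applied to
`T/c, …, T/c, ω, …, ω ∈ {ω}`), full mass ⟹ all Lelong numbers vanish (Guedj–Zeriahi 2007,
Cor. 1.8, class `𝓔(X, ω)`). JUNK ANALYSIS: for `T` regular off a closed complete pluripolar set
the fields determine `mass` (`= regularMass`); for other `T` they only locate `mass j` in the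
interval `[regularMass j, (deg T)^j]`, so `∀ M : NonPluripolarMongeAmpereMass T, P M.mass` is a
statement about every assignment compatible with these theorems (sound for consequences,
incomplete), and `Nonempty (NonPluripolarMongeAmpereMass T)` is (an instance of) the cited
theorems, not a triviality. Route statements should quantify `(M : NonPluripolarMongeAmpereMass T)`
as an explicit datum.

## Named facts (statements as printed, specialised to `X = ℙᴺ`, honest objects only)

* `Siu1974_isAnalyticSet_lelongUpperLevelSet` — Siu 1974: `E_c(T)` is an analytic subset, `c > 0`.
* `BoucksomEtAl2010_regularMass_le_degree_pow` — `∫_{Reg T} T^j ∧ ω^{N-j} ≤ (deg T)^j` (BEGZ Prop. 1.20 + locality).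
* `GuedjZeriahi2007_lelongNumber_eq_zero_of_regularMass_eq` — if `∫_{Reg T} T^N = (deg T)^N > 0` then `ν(T, ·) ≡ 0`
  (then `T` has full Monge–Ampère mass; Guedj–Zeriahi 2007 Cor. 1.8).

## Deliberately NOT here (and why)

* Demailly's self-intersection inequality (J. Algebraic Geom. 1 (1992), Thm. 1.7; requested as
  "mass defect ≥ Σ_Z ν(T,Z)^j deg Z"). AS PRINTED it reads, on a compact Kähler `X` with
  `O_{TX}(1)` semipositive (true for `ℙᴺ`, `u = 0`): `{T}^p` is represented by a closed positive
  `Θ_p ≥ Σ_k (ν_{p,k} - b₁)⋯(ν_{p,k} - b_p) [Z_{p,k}] + T_{ac}^p`, with JUMPING VALUES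
  `0 = b₁ ≤ ⋯ ≤ b_p` (`codim E_c(T) = p` for `c ∈ ]b_p, b_{p+1}]`), `Z_{p,k}` the
  `p`-codimensional components of the `E_c(T)` and `T_{ac}` the absolutely continuous part — i.e.
  WEAKER than the paraphrase (the corrections `b_i` cannot be dropped) and phrased with components,
  codimension, degrees of subvarieties and `T_{ac}`, none of which is available on `ℙᴺ` in the
  tree yet; note also that it bounds `{T}^p - T_{ac}^p` with `T_{ac}^p` the pointwise power of the
  absolutely continuous part (`≥ 1_{Reg} T^p`, so it controls `(deg T)^p - regularMass p`), which
  is not the same object as the non-pluripolar mass defect `(deg T)^p - ∫⟨T^p⟩ ∧ ω^{N-p}`. To be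
  vendored in its printed form once `deg Z` for projective subvarieties exists.
* The Skoda–El Mir extension theorem, Demailly regularisation, the Bedford–Taylor product and the
  non-pluripolar product as currents, monotonicity of masses (BEGZ Thm. 1.16 / Witt Nyström),
  b-divisorial Chern–Weil (Botero–Burgos–Holmes–de Jong 2022, Burgos–Kramer–Kühn 2016): separate
  notions; the consuming route only needs the numbers, which for its smooth-off-a-divisor currents
  are `regularMass` (= `BiextensionHeight.massOf` up to the null set where the potential is `C²`
  over the divisor).

## References

* [BoucksomEtAl2010] S. Boucksom, P. Eyssidieux, V. Guedj, A. Zeriahi, Monge–Ampère equations in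
  big cohomology classes, Acta Math. 205 (2010), arXiv:0812.3674: §1.1–1.2 (Def. 1.1, Def. 1.2,
  Prop. 1.4, Prop. 1.6, Thm. 1.8), Thm. 1.16, Prop. 1.20, Def. 1.21, Cor. 2.15 (READ).
* [GuedjZeriahi2007] V. Guedj, A. Zeriahi, The weighted Monge–Ampère energy of quasiplurisubharmonic
  functions, J. Funct. Anal. 250 (2007): Def. 1.1 (`𝓔(X, ω)`), Cor. 1.8 (READ).
* [Siu1974] Y.-T. Siu, Analyticity of sets associated to Lelong numbers and the extension of closed
  positive currents, Invent. Math. 27 (1974): Main Theorem (as recalled in Demailly 1992, §1).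
* [DangDoPham2025] Q.-T. Dang, H.-S. Do, H. H. Pham, Math. Z. 311 (2025): §2.1 (Lelong numbers,
  non-pluripolar product recalled), Cor. 2.6.
* J.-P. Demailly, Regularization of closed positive currents and intersection theory, J. Algebraic
  Geom. 1 (1992) 361–409: §1, Thm. 1.7, Lemma 7.3 (READ; not vendored, see above).
-/

noncomputable section

open scoped Topology ENNReal Manifold ContDiff LinearAlgebra.Projectivization
open MeasureTheory Filter Set Metric
open Literature.AlgebraicGeometry.HodgeTheory.BiextensionHeight (heightDensity chartVec)

namespace Literature.Analysis.Pluripotential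

/-! ## Complements to `Plurisubharmonic.lean`: circle means vs. `Real.circleAverage`, and the model
examples `c log |a + b τ|`, `c log ‖z‖_∞` (kept here to land together with their first use, the
example currents `ClosedPositiveOneOneCurrent.logSupNorm`; names live in the directory namespace,
so a later move into `Plurisubharmonic.lean` is transparent). -/

/-! ### Bridge to Mathlib's `Real.circleAverage`; the model example `c · log ‖·‖` -/

section Bridge

/-- For a circle-integrable REAL function the `[-∞, +∞]`-valued mean `circleMean` is Mathlib's
`Real.circleAverage` (Bochner integral): `∫ g⁺ - ∫ g⁻` is the Lebesgue integral. [folklore] -/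
theorem circleMean_coe_eq_circleAverage (f : ℂ → ℝ) (c : ℂ) (R : ℝ) (hf : CircleIntegrable f c R) :
    circleMean (fun z ↦ (f z : EReal)) c R = ((Real.circleAverage f c R : ℝ) : EReal) := by
  have hpi : 0 < 2 * Real.pi := by positivity
  set g : ℝ → ℝ := fun θ ↦ f (circleMap c R θ) with hg
  have hgi : IntegrableOn g (Ioc 0 (2 * Real.pi)) :=
    (intervalIntegrable_iff_integrableOn_Ioc_of_le hpi.le).1 hf
  have hA : ∫⁻ θ in Ioc (0 : ℝ) (2 * Real.pi), ENNReal.ofReal (g θ) < ⊤ := by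
    refine lt_of_le_of_lt (lintegral_mono fun θ ↦ ?_) hgi.hasFiniteIntegral
    exact Real.ofReal_le_enorm (g θ)
  have hB : ∫⁻ θ in Ioc (0 : ℝ) (2 * Real.pi), ENNReal.ofReal (-g θ) < ⊤ := by
    refine lt_of_le_of_lt (lintegral_mono fun θ ↦ ?_) hgi.neg.hasFiniteIntegral
    exact Real.ofReal_le_enorm (-g θ)
  have hint : ∫ θ in Ioc (0 : ℝ) (2 * Real.pi), g θ =
      (∫⁻ θ in Ioc (0 : ℝ) (2 * Real.pi), ENNReal.ofReal (g θ)).toReal -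
      (∫⁻ θ in Ioc (0 : ℝ) (2 * Real.pi), ENNReal.ofReal (-g θ)).toReal :=
    integral_eq_lintegral_pos_part_sub_lintegral_neg_part hgi
  have hcoe : ∀ x : ℝ, (x : EReal).toENNReal = ENNReal.ofReal x := fun x ↦ by
    rw [EReal.toENNReal_of_ne_top (EReal.coe_ne_top x), EReal.toReal_coe]
  have hup : circleUpperMean (fun z ↦ (f z : EReal)) c R =
      (∫⁻ θ in Ioc (0 : ℝ) (2 * Real.pi), ENNReal.ofReal (g θ)) / ENNReal.ofReal (2 * Real.pi) := by
    simp only [circleUpperMean, hg, hcoe]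
  have hlo : circleLowerMean (fun z ↦ (f z : EReal)) c R =
      (∫⁻ θ in Ioc (0 : ℝ) (2 * Real.pi), ENNReal.ofReal (-g θ)) / ENNReal.ofReal (2 * Real.pi) := by
    simp only [circleLowerMean, hg, ← EReal.coe_neg, hcoe]
  rw [circleMean, hup, hlo]
  set A := ∫⁻ θ in Ioc (0 : ℝ) (2 * Real.pi), ENNReal.ofReal (g θ)
  set B := ∫⁻ θ in Ioc (0 : ℝ) (2 * Real.pi), ENNReal.ofReal (-g θ)
  have hp : ENNReal.ofReal (2 * Real.pi) ≠ 0 := (ENNReal.ofReal_pos.2 hpi).ne'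
  have hA' : A / ENNReal.ofReal (2 * Real.pi) ≠ ⊤ := ENNReal.div_ne_top hA.ne hp
  have hB' : B / ENNReal.ofReal (2 * Real.pi) ≠ ⊤ := ENNReal.div_ne_top hB.ne hp
  rw [← EReal.coe_ennreal_toReal hA', ← EReal.coe_ennreal_toReal hB', ← EReal.coe_sub,
    ENNReal.toReal_div, ENNReal.toReal_div, ENNReal.toReal_ofReal hpi.le, ← sub_div,
    ← hint, Real.circleAverage_def, intervalIntegral.integral_of_le hpi.le, smul_eq_mul]
  congr 1
  rw [hg]; ring

/-- Subharmonicity only depends on the values on `U`. [folklore] -/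
theorem IsSubharmonicOn.congr {u u' : ℂ → EReal} {U : Set ℂ} (h : IsSubharmonicOn u U)
    (huu' : EqOn u u' U) : IsSubharmonicOn u' U := by
  refine ⟨fun x hx ↦ ?_, fun z hz ↦ huu' hz ▸ h.lt_top hz, fun c R hR hcl ↦ ?_⟩
  · intro y hy
    rw [← huu' hx] at hy
    filter_upwards [h.upperSemicontinuousOn x hx y hy, self_mem_nhdsWithin] with x' hx' hx'U
    rwa [← huu' hx'U]
  · have hc : c ∈ U := hcl (mem_closedBall_self hR.le)
    have hcirc : ∀ θ, u (circleMap c R θ) = u' (circleMap c R θ) := fun θ ↦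
      huu' (hcl (circleMap_mem_closedBall c hR.le θ))
    have key := h.le_circleMean hR hcl
    rw [huu' hc] at key
    simpa only [circleMean, circleUpperMean, circleLowerMean, hcirc] using key

/-- A function continuous within `U` at each point of `U` is upper semicontinuous on `U`
(for `EReal`-valued functions). [folklore] -/
theorem upperSemicontinuousOn_of_continuousOn {X : Type*} [TopologicalSpace X] {u : X → EReal}
    {U : Set X} (h : ContinuousOn u U) : UpperSemicontinuousOn u U :=
  fun x hx _y hy ↦ (h x hx).eventually (eventually_lt_nhds hy)

/-- **The model subharmonic function**: for `a, b ∈ ℂ` and `c ≥ 0`, `τ ↦ c log |a + b τ|` satisfies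
the mean-value inequality over every circle on which... more precisely: if `a + b τ₀ ≠ 0` then
`c log |a + b τ₀| ≤ (2π)⁻¹ ∫ c log |a + b (τ₀ + R e^{iθ})| dθ` (Jensen's inequality for an affine
function; equality when `a + b τ` has no zero in the open disc). Junk `Real.log 0 = 0` at a zero
on the circle is invisible to the integral. [cite: HormanderSCV1973, Cor. 1.6.6] -/
theorem mul_log_norm_affine_le_circleAverage {a b τ₀ : ℂ} (h0 : a + b * τ₀ ≠ 0) {c : ℝ}
    (hc : 0 ≤ c) {R : ℝ} (hR : R ≠ 0) :
    c * Real.log ‖a + b * τ₀‖ ≤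
      Real.circleAverage (fun τ ↦ c * Real.log ‖a + b * τ‖) τ₀ R := by
  by_cases hb : b = 0
  · subst hb
    simp [Real.circleAverage_const]
  · -- `log |a + b τ| = log |b| + log |τ - (-a/b)|`
    have hsplit : ∀ τ : ℂ, a + b * τ ≠ 0 →
        Real.log ‖a + b * τ‖ = Real.log ‖b‖ + Real.log ‖τ - (-a / b)‖ := by
      intro τ hτ
      have : a + b * τ = b * (τ - (-a / b)) := by field_simp; ring
      rw [this, norm_mul, Real.log_mul (norm_ne_zero_iff.2 hb)]
      rw [this] at hτ
      exact norm_ne_zero_iff.2 (right_ne_zero_of_mul hτ)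
    -- the circle average of the right-hand side, computed by Mathlib's Jensen-type formula
    have hlog : Real.circleAverage (fun τ ↦ Real.log ‖τ - (-a / b)‖) τ₀ R =
        Real.log R + Real.posLog (R⁻¹ * ‖τ₀ - (-a / b)‖) :=
      circleAverage_log_norm_sub_const_eq_log_radius_add_posLog hR
    have hint1 : CircleIntegrable (fun τ ↦ Real.log ‖τ - (-a / b)‖) τ₀ R :=
      MeromorphicOn.circleIntegrable_log_norm (fun _ _ ↦ by fun_prop)
    have hint2 : CircleIntegrable (fun τ : ℂ ↦ Real.log ‖a + b * τ‖) τ₀ R :=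
      MeromorphicOn.circleIntegrable_log_norm (fun _ _ ↦ by fun_prop)
    -- the two integrands agree off the (at most one) zero of `a + b τ`, a codiscrete set
    have hcod : (fun τ : ℂ ↦ Real.log ‖a + b * τ‖) =ᶠ[codiscreteWithin (Metric.sphere τ₀ |R|)]
        fun τ ↦ Real.log ‖b‖ + Real.log ‖τ - (-a / b)‖ := by
      have : {τ : ℂ | a + b * τ ≠ 0} ∈ codiscreteWithin (Metric.sphere τ₀ |R|) := by
        apply codiscreteWithin_iff_locallyFiniteComplementWithin.2
        intro z _
        refine ⟨Set.univ, univ_mem, ?_⟩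
        simp only [Set.univ_inter]
        apply Set.Subsingleton.finite
        intro z₁ hz₁ z₂ hz₂
        simp only [Set.mem_sdiff, mem_setOf_eq, not_not] at hz₁ hz₂
        have e1 : z₁ = -a / b := by field_simp; linear_combination hz₁.2
        have e2 : z₂ = -a / b := by field_simp; linear_combination hz₂.2
        rw [e1, e2]
      filter_upwards [this] with τ hτ
      exact hsplit τ hτ
    have havg : Real.circleAverage (fun τ : ℂ ↦ Real.log ‖a + b * τ‖) τ₀ R =
        Real.log ‖b‖ + (Real.log R + Real.posLog (R⁻¹ * ‖τ₀ - (-a / b)‖)) := by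
      rw [Real.circleAverage_congr_codiscreteWithin hcod hR,
        Real.circleAverage_fun_add (circleIntegrable_const _ _ _) hint1,
        Real.circleAverage_const, hlog]
    have hsmul : Real.circleAverage (fun τ ↦ c * Real.log ‖a + b * τ‖) τ₀ R =
        c * Real.circleAverage (fun τ : ℂ ↦ Real.log ‖a + b * τ‖) τ₀ R := by
      rw [← smul_eq_mul, ← Real.circleAverage_fun_smul]
      rfl
    rw [hsmul, havg, hsplit τ₀ h0]
    refine mul_le_mul_of_nonneg_left ?_ hc
    have hτa : τ₀ - (-a / b) ≠ 0 := by
      intro h; apply h0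
      have : τ₀ = -a / b := sub_eq_zero.1 h
      rw [this]; field_simp; ring
    have hRpos : 0 < |R| := abs_pos.2 hR
    calc Real.log ‖b‖ + Real.log ‖τ₀ - (-a / b)‖
        = Real.log ‖b‖ + (Real.log R + Real.log (R⁻¹ * ‖τ₀ - (-a / b)‖)) := by
          rw [Real.log_mul (inv_ne_zero hR) (norm_ne_zero_iff.2 hτa), Real.log_inv]; ring
      _ ≤ Real.log ‖b‖ + (Real.log R + Real.posLog (R⁻¹ * ‖τ₀ - (-a / b)‖)) := by
          gcongr
          rw [Real.posLog_apply]
          exact le_max_right _ _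

end Bridge


section LogSupNorm

/-- The complement of the zero set of a non-identically-vanishing affine function `τ ↦ a + b τ`
is codiscrete within any set (the zero set has at most one point). [folklore] -/
theorem setOf_affine_ne_zero_mem_codiscreteWithin {a b τ₀ : ℂ} (h0 : a + b * τ₀ ≠ 0)
    (S : Set ℂ) : {τ : ℂ | a + b * τ ≠ 0} ∈ codiscreteWithin S := by
  apply codiscreteWithin_iff_locallyFiniteComplementWithin.2
  intro z _
  refine ⟨Set.univ, univ_mem, ?_⟩
  simp only [Set.univ_inter]
  apply Set.Subsingleton.finite
  intro z₁ hz₁ z₂ hz₂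
  simp only [Set.mem_sdiff, mem_setOf_eq, not_not] at hz₁ hz₂
  by_cases hb : b = 0
  · exfalso; apply h0
    have := hz₁.2
    simp only [hb, zero_mul, add_zero] at this ⊢
    exact this
  · have e1 : z₁ = -a / b := by field_simp; linear_combination hz₁.2
    have e2 : z₂ = -a / b := by field_simp; linear_combination hz₂.2
    rw [e1, e2]

variable {ι : Type*} [Fintype ι] [Nonempty ι]

/-- For `f : ι → ℂ` (sup norm) some coordinate realises the norm. [folklore] -/
theorem exists_norm_apply_eq_norm (f : ι → ℂ) : ∃ k, ‖f k‖ = ‖f‖ := by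
  obtain ⟨k, -, hk⟩ := Finset.exists_max_image Finset.univ (fun i ↦ ‖f i‖) Finset.univ_nonempty
  exact ⟨k, le_antisymm (norm_le_pi_norm f k)
    ((pi_norm_le_iff_of_nonneg (norm_nonneg _)).2 fun i ↦ hk i (Finset.mem_univ i))⟩

/-- **The model example, slice form**: for `z, w ∈ ℂ^ι` (sup norm) and `c ≥ 0` the function
`τ ↦ c log ‖z + τ w‖` is subharmonic on the open set `{τ | z + τ w ≠ 0}`. Proof: continuity gives
upper semicontinuity; for the mean-value inequality at `τ₀` pick a coordinate `k` with
`|z_k + τ₀ w_k| = ‖z + τ₀ w‖`, apply Jensen's inequality to the affine function `z_k + τ w_k`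
(`mul_log_norm_affine_le_circleAverage`) and compare with `c log ‖z + τ w‖ ≥ c log |z_k + τ w_k|`
on the circle (off the at most one zero of the coordinate, a codiscrete set).
[cite: HormanderSCV1973, Cor. 1.6.6 and Thm. 1.6.2 (max of subharmonic functions)] -/
theorem isSubharmonicOn_mul_log_norm_add_smul (z w : ι → ℂ) {c : ℝ} (hc : 0 ≤ c) :
    IsSubharmonicOn (fun τ : ℂ ↦ ((c * Real.log ‖z + τ • w‖ : ℝ) : EReal)) {τ | z + τ • w ≠ 0} := by
  set S : Set ℂ := {τ | z + τ • w ≠ 0} with hS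
  -- the real-valued function and its continuity on `S`
  set F : ℂ → ℝ := fun τ ↦ c * Real.log ‖z + τ • w‖ with hF
  have hcontF : ContinuousOn F S := by
    refine ContinuousOn.mul continuousOn_const ((ContinuousOn.norm ?_).log fun τ hτ ↦ ?_)
    · exact (continuous_const.add (continuous_id.smul continuous_const)).continuousOn
    · exact norm_ne_zero_iff.2 hτ
  refine ⟨?_, fun τ _ ↦ EReal.coe_lt_top _, fun τ₀ R hR hcl ↦ ?_⟩
  · exact upperSemicontinuousOn_of_continuousOn (continuous_coe_real_ereal.comp_continuousOn hcontF)
  -- the mean-value inequality at `τ₀`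
  have h0 : z + τ₀ • w ≠ 0 := hcl (mem_closedBall_self hR.le)
  obtain ⟨k, hk⟩ := exists_norm_apply_eq_norm (z + τ₀ • w)
  have hk' : z k + w k * τ₀ = (z + τ₀ • w) k := by simp [mul_comm]
  have hcoord : ∀ τ : ℂ, z k + w k * τ = (z + τ • w) k := fun τ ↦ by simp [mul_comm]
  have h0k : z k + w k * τ₀ ≠ 0 := by
    rw [hk', ← norm_ne_zero_iff, hk, norm_ne_zero_iff]; exact h0
  -- Jensen for the coordinate
  have hJ := mul_log_norm_affine_le_circleAverage h0k hc hR.ne'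
  -- integrability
  have hsphere : sphere τ₀ |R| ⊆ S := (abs_of_pos hR).symm ▸ sphere_subset_closedBall.trans hcl
  have hintF : CircleIntegrable F τ₀ R := (hcontF.mono hsphere).circleIntegrable'
  have hintk : CircleIntegrable (fun τ : ℂ ↦ c * Real.log ‖z k + w k * τ‖) τ₀ R := by
    have : CircleIntegrable (fun τ : ℂ ↦ Real.log ‖z k + w k * τ‖) τ₀ R :=
      MeromorphicOn.circleIntegrable_log_norm (fun _ _ ↦ by fun_prop)
    exact this.const_smul (a := c)
  -- modify the coordinate function at its (at most one) zero to compare pointwise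
  set G : ℂ → ℝ := fun τ ↦ if z k + w k * τ = 0 then F τ else c * Real.log ‖z k + w k * τ‖ with hG
  have hGeq : (fun τ : ℂ ↦ c * Real.log ‖z k + w k * τ‖) =ᶠ[codiscreteWithin (sphere τ₀ |R|)] G := by
    filter_upwards [setOf_affine_ne_zero_mem_codiscreteWithin h0k (sphere τ₀ |R|)] with τ hτ
    simp [hG, hτ]
  have hintG : CircleIntegrable G τ₀ R := hintk.congr_codiscreteWithin hGeq
  have hGle : ∀ τ ∈ sphere τ₀ |R|, G τ ≤ F τ := by
    intro τ hτ
    by_cases hz : z k + w k * τ = 0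
    · simp [hG, hz]
    · simp only [hG, hz, if_false, hF]
      refine mul_le_mul_of_nonneg_left (Real.log_le_log (norm_pos_iff.2 hz) ?_) hc
      rw [hcoord τ]; exact norm_le_pi_norm _ k
  have hmono : Real.circleAverage G τ₀ R ≤ Real.circleAverage F τ₀ R :=
    Real.circleAverage_mono hintG hintF hGle
  -- assemble
  have hbridge := circleMean_coe_eq_circleAverage F τ₀ R hintF
  change ((F τ₀ : ℝ) : EReal) ≤ circleMean (fun τ ↦ ((F τ : ℝ) : EReal)) τ₀ R
  rw [hbridge, EReal.coe_le_coe_iff]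
  calc F τ₀ = c * Real.log ‖z k + w k * τ₀‖ := by rw [hF, hk', hk]
    _ ≤ Real.circleAverage (fun τ ↦ c * Real.log ‖z k + w k * τ‖) τ₀ R := hJ
    _ = Real.circleAverage G τ₀ R := Real.circleAverage_congr_codiscreteWithin hGeq hR.ne'
    _ ≤ Real.circleAverage F τ₀ R := hmono

/-- **The model plurisubharmonic function**: for `c ≥ 0` the function `v ↦ c log ‖v‖` (sup norm
on `ℂ^ι`, honest value `-∞` at `v = 0`) is plurisubharmonic on `ℂ^ι ∖ {0}`: it is continuous
there and its restrictions to complex lines are the subharmonic functions of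
`isSubharmonicOn_mul_log_norm_add_smul`. It is the cone potential of the closed positive current
`c · dd^c log ‖z‖_∞` of degree `c` on `ℙ(ℂ^ι)`. [cite: HormanderSCV1973, Def. 2.6.1 and Cor. 1.6.6] -/
theorem isPlurisubharmonicOn_mul_log_norm {c : ℝ} (hc : 0 ≤ c) :
    IsPlurisubharmonicOn
      (fun v : ι → ℂ ↦ if v = 0 then (⊥ : EReal) else ((c * Real.log ‖v‖ : ℝ) : EReal)) {0}ᶜ := by
  set V : (ι → ℂ) → EReal := fun v ↦ if v = 0 then (⊥ : EReal) else ((c * Real.log ‖v‖ : ℝ) : EReal)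
    with hV
  have hVeq : EqOn (fun v : ι → ℂ ↦ ((c * Real.log ‖v‖ : ℝ) : EReal)) V {0}ᶜ := fun v hv ↦ by
    simp [hV, show v ≠ 0 from hv]
  refine ⟨?_, fun v hv ↦ ?_, fun x y ↦ ?_⟩
  · -- upper semicontinuity: `V` is continuous on `{0}ᶜ`
    have hcont : ContinuousOn (fun v : ι → ℂ ↦ ((c * Real.log ‖v‖ : ℝ) : EReal)) {0}ᶜ := by
      refine continuous_coe_real_ereal.comp_continuousOn (continuousOn_const.mul ?_)
      exact (continuous_norm.continuousOn).log fun v hv ↦ norm_ne_zero_iff.2 hv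
    exact upperSemicontinuousOn_of_continuousOn (hcont.congr fun v hv ↦ (hVeq hv).symm)
  · rw [← hVeq hv]; exact EReal.coe_lt_top _
  · -- slices
    have hsub := isSubharmonicOn_mul_log_norm_add_smul x y hc
    refine hsub.congr fun τ hτ ↦ ?_
    exact hVeq hτ

end LogSupNorm

section LelongZero

variable {E : Type*} [NormedAddCommGroup E]

/-- A function bounded below by a real number and bounded above on a (non-trivial) punctured
neighbourhood of `a` has Lelong number `0` at `a`: no slope `γ > 0` is admissible, as
`γ log ‖z - a‖ + C → -∞`. (E.g. a psh function finite and continuous at `a`.) [folklore] -/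
theorem lelongNumber_eq_zero_of_bounded {u : E → EReal} {a : E} [NeBot (𝓝[≠] a)] {m C : ℝ}
    (hm : ∀ᶠ z in 𝓝[≠] a, ((m : ℝ) : EReal) ≤ u z)
    (hC : ∀ᶠ z in 𝓝[≠] a, u z ≤ ((C : ℝ) : EReal)) : lelongNumber u a = 0 := by
  have hS : lelongSlopes u a = {0} := by
    refine Subset.antisymm (fun γ hγ ↦ ?_) (singleton_subset_iff.2 (zero_mem_lelongSlopes hC))
    obtain ⟨hγ0, C', hC'⟩ := hγ
    rcases hγ0.eq_or_lt with h | hγpos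
    · exact mem_singleton_iff.2 h.symm
    · exfalso
      have hball : ∀ᶠ z in 𝓝[≠] a, ‖z - a‖ < Real.exp ((m - C' - 1) / γ) := by
        have : Metric.ball a (Real.exp ((m - C' - 1) / γ)) ∈ 𝓝 a :=
          Metric.ball_mem_nhds a (Real.exp_pos _)
        filter_upwards [nhdsWithin_le_nhds this] with z hz
        rwa [Metric.mem_ball, dist_eq_norm] at hz
      obtain ⟨z, ⟨⟨hz1, hz2⟩, hz3⟩, hz4⟩ :=
        (((hm.and hC').and hball).and self_mem_nhdsWithin).exists
      have hza : 0 < ‖z - a‖ := norm_pos_iff.2 (sub_ne_zero.2 hz4)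
      have hlog : Real.log ‖z - a‖ < (m - C' - 1) / γ := by
        rw [← Real.log_exp ((m - C' - 1) / γ)]
        exact Real.log_lt_log hza hz3
      have h1 : γ * Real.log ‖z - a‖ < m - C' - 1 :=
        calc γ * Real.log ‖z - a‖ < γ * ((m - C' - 1) / γ) := mul_lt_mul_of_pos_left hlog hγpos
          _ = m - C' - 1 := by field_simp
      have h2 : ((m : ℝ) : EReal) ≤ ((γ * Real.log ‖z - a‖ + C' : ℝ) : EReal) := hz1.trans hz2
      rw [EReal.coe_le_coe_iff] at h2
      linarith
  rw [lelongNumber_eq_sSup, hS, csSup_singleton]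

/-- A real-valued function continuous at `a` (coerced to `EReal`, possibly modified away from a
punctured neighbourhood) has Lelong number `0` at `a`. [folklore] -/
theorem lelongNumber_eq_zero_of_continuousAt {u : E → EReal} {a : E} [NeBot (𝓝[≠] a)]
    {f : E → ℝ} (hf : ContinuousAt f a) (huf : ∀ᶠ z in 𝓝[≠] a, u z = ((f z : ℝ) : EReal)) :
    lelongNumber u a = 0 := by
  have hI : ∀ᶠ z in 𝓝 a, f z ∈ Ioo (f a - 1) (f a + 1) :=
    hf.eventually (Ioo_mem_nhds (sub_one_lt _) (lt_add_one _))
  refine lelongNumber_eq_zero_of_bounded (m := f a - 1) (C := f a + 1) ?_ ?_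
  · filter_upwards [huf, nhdsWithin_le_nhds hI] with z hz hzI
    rw [hz, EReal.coe_le_coe_iff]; exact hzI.1.le
  · filter_upwards [huf, nhdsWithin_le_nhds hI] with z hz hzI
    rw [hz, EReal.coe_le_coe_iff]; exact hzI.2.le

end LelongZero

variable {N : ℕ}

/-! ### Logarithmically homogeneous potentials and currents on `ℙᴺ` -/

/-- `V : ℂ^{N+1} → [-∞, +∞]` is **logarithmically homogeneous of degree `c`** if
`V(a • v) = V(v) + c log |a|` for all `a ∈ ℂ ∖ {0}` and `v ≠ 0` (the cone potentials of closed
positive `(1,1)`-currents of degree `c` on `ℙᴺ`; cf. `BiextensionHeightPackage.pot_smul`).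
[folklore] -/
def IsLogHomogeneous (V : (Fin (N + 1) → ℂ) → EReal) (c : ℝ) : Prop :=
  ∀ (a : ℂ) (v : Fin (N + 1) → ℂ), a ≠ 0 → v ≠ 0 →
    V (a • v) = V v + ((c * Real.log ‖a‖ : ℝ) : EReal)

/-! ### Lelong numbers along the fibres of `ℂ^{N+1} ∖ {0} → ℙᴺ` -/

section Dilation

variable {E : Type*} [NormedAddCommGroup E] [NormedSpace ℂ E]

/-- If `V(c z) = V(z) + d log |c|` for all `z ≠ 0` (one fixed `c ≠ 0`), every admissible Lelong
slope of `V` at `v ≠ 0` is admissible at `c • v`: transport along `y ↦ c⁻¹ y`, using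
`log ‖c⁻¹ y - v‖ = log ‖y - c v‖ - log |c|`. [folklore] -/
theorem lelongSlopes_subset_smul {V : E → EReal} {d : ℝ} {c : ℂ} (hc : c ≠ 0)
    (hV : ∀ z : E, z ≠ 0 → V (c • z) = V z + ((d * Real.log ‖c‖ : ℝ) : EReal))
    {v : E} (hv : v ≠ 0) : lelongSlopes V v ⊆ lelongSlopes V (c • v) := by
  rintro γ ⟨hγ, C, hC⟩
  refine ⟨hγ, C + (d - γ) * Real.log ‖c‖, ?_⟩
  have hcont : Tendsto (fun y : E ↦ c⁻¹ • y) (𝓝[≠] (c • v)) (𝓝[≠] v) := by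
    refine tendsto_nhdsWithin_of_tendsto_nhds_of_eventually_within _ ?_ ?_
    · have : Tendsto (fun y : E ↦ c⁻¹ • y) (𝓝 (c • v)) (𝓝 (c⁻¹ • (c • v))) :=
        (continuous_const_smul c⁻¹).continuousAt
      rw [inv_smul_smul₀ hc] at this
      exact this.mono_left nhdsWithin_le_nhds
    · refine eventually_nhdsWithin_of_forall fun y hy ↦ ?_
      intro h
      apply hy
      have : c • (c⁻¹ • y) = c • v := by rw [mem_singleton_iff.mp h]
      rwa [smul_inv_smul₀ hc] at this
  have hv0 : ∀ᶠ y in 𝓝[≠] (c • v), c⁻¹ • y ≠ 0 := by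
    have : ∀ᶠ y in 𝓝 (c • v), y ≠ 0 := isOpen_ne.eventually_mem (smul_ne_zero hc hv)
    filter_upwards [nhdsWithin_le_nhds this] with y hy
    exact smul_ne_zero (inv_ne_zero hc) hy
  filter_upwards [hcont.eventually hC, hv0, self_mem_nhdsWithin] with y hy hy0 hyne
  have hyne' : ‖y - c • v‖ ≠ 0 := by
    rw [norm_ne_zero_iff, sub_ne_zero]; exact hyne
  have key : V y = V (c⁻¹ • y) + ((d * Real.log ‖c‖ : ℝ) : EReal) := by
    have := hV (c⁻¹ • y) hy0
    rwa [smul_inv_smul₀ hc] at this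
  have hnorm : ‖c⁻¹ • y - v‖ = ‖y - c • v‖ / ‖c‖ := by
    have : c⁻¹ • y - v = c⁻¹ • (y - c • v) := by rw [smul_sub, inv_smul_smul₀ hc]
    rw [this, norm_smul, norm_inv, mul_comm, div_eq_mul_inv]
  rw [key]
  calc V (c⁻¹ • y) + ((d * Real.log ‖c‖ : ℝ) : EReal)
      ≤ ((γ * Real.log ‖c⁻¹ • y - v‖ + C : ℝ) : EReal) + ((d * Real.log ‖c‖ : ℝ) : EReal) := by
        gcongr
    _ = ((γ * Real.log ‖y - c • v‖ + (C + (d - γ) * Real.log ‖c‖) : ℝ) : EReal) := by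
        rw [← EReal.coe_add, hnorm, Real.log_div hyne' (norm_ne_zero_iff.mpr hc)]
        congr 1
        ring

end Dilation

namespace IsLogHomogeneous

variable {V : (Fin (N + 1) → ℂ) → EReal} {d : ℝ}

/-- For a log-homogeneous `V` the admissible Lelong slopes are the same at all points of a
punctured line `ℂˣ • v`. [folklore] -/
theorem lelongSlopes_smul (hV : IsLogHomogeneous V d) {c : ℂ} (hc : c ≠ 0)
    {v : Fin (N + 1) → ℂ} (hv : v ≠ 0) : lelongSlopes V (c • v) = lelongSlopes V v := by
  refine Subset.antisymm ?_ (lelongSlopes_subset_smul hc (fun z hz ↦ hV c z hc hz) hv)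
  have h := lelongSlopes_subset_smul (V := V) (d := d) (inv_ne_zero hc)
    (fun z hz ↦ hV c⁻¹ z (inv_ne_zero hc) hz) (smul_ne_zero hc hv)
  rwa [inv_smul_smul₀ hc] at h

/-- For a log-homogeneous `V` the Lelong number is constant along punctured lines through `0`:
`ν(V, c v) = ν(V, v)` — so the Lelong number of a current on `ℙᴺ` at `x` is well defined through
any representative of `x`. [folklore] -/
theorem lelongNumber_smul (hV : IsLogHomogeneous V d) {c : ℂ} (hc : c ≠ 0)
    {v : Fin (N + 1) → ℂ} (hv : v ≠ 0) : lelongNumber V (c • v) = lelongNumber V v := by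
  rw [lelongNumber_eq_sSup, lelongNumber_eq_sSup, hV.lelongSlopes_smul hc hv]

end IsLogHomogeneous

/-- A **closed positive `(1,1)`-current on `ℙᴺ(ℂ)`**, presented by its cone potential: the data of
a plurisubharmonic function `pot = V` on `ℂ^{N+1} ∖ {0}`, not identically `-∞`, logarithmically
homogeneous of degree `degree = c ≥ 0` (and `≢ -∞` near each point); the current is `T` with
`π^*T = dd^c V`, its cohomology
class is `c {ω_FS}` and `c = deg T = ∫ T ∧ ω_FS^{N-1}`. Every closed positive `(1,1)`-current on
`ℙᴺ` is so presented, uniquely up to `V ↦ V + const` (dictionary `PSH(ℙᴺ, c ω_FS)` ↔ Lelong class;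
`V` extends across `0` as a psh function when `N ≥ 1`). The value `pot 0` is junk. Examples:
`V = c log ‖z‖` (`T = c ω`), `V = log |F|` for a homogeneous polynomial `F` of degree `c`
(`T = [F = 0]`, current of integration), `V =` the El Mir–Skoda extension of a height potential.
[folklore] -/
structure ClosedPositiveOneOneCurrent (N : ℕ) where
  /-- The cone potential `V : ℂ^{N+1} → [-∞, +∞]` (`π^* T = dd^c V` off `0`). [folklore] -/
  pot : (Fin (N + 1) → ℂ) → EReal
  /-- The degree `c = deg T ≥ 0` (`{T} = c {ω_FS}`). [folklore] -/
  degree : ℝ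
  /-- `deg T ≥ 0`. [folklore] -/
  degree_nonneg : 0 ≤ degree
  /-- `V` is plurisubharmonic on `ℂ^{N+1} ∖ {0}` (positivity and closedness of `T`). [folklore] -/
  isPlurisubharmonicOn_pot : IsPlurisubharmonicOn pot {0}ᶜ
  /-- `V(a v) = V(v) + c log |a|` (`dd^c V` descends to `ℙᴺ`, with class `c{ω}`). [folklore] -/
  isLogHomogeneous_pot : IsLogHomogeneous pot degree
  /-- `V ≢ -∞` near every point of `ℂ^{N+1} ∖ {0}` (for a psh `V` on this connected open set
  this is equivalent to `V ≢ -∞`, i.e. `V ∈ L¹_loc` and `dd^c V` is a current; stated locally so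
  that `ν(V, v)` is the classical, finite Lelong number at every `v ≠ 0` without appeal to that
  theorem). [folklore] -/
  frequently_ne_bot : ∀ v : Fin (N + 1) → ℂ, v ≠ 0 → ∃ᶠ y in 𝓝 v, pot y ≠ ⊥

namespace ClosedPositiveOneOneCurrent

/-- The **zero current** (`V ≡ 0`, `deg = 0`). [folklore] -/
def zero (N : ℕ) : ClosedPositiveOneOneCurrent N where
  pot := fun _ ↦ ((0 : ℝ) : EReal)
  degree := 0
  degree_nonneg := le_rfl
  isPlurisubharmonicOn_pot := isPlurisubharmonicOn_const 0 _
  isLogHomogeneous_pot := fun a v _ _ ↦ by simp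
  frequently_ne_bot := fun _ _ ↦ (Eventually.of_forall fun _ ↦ by simp).frequently

/-- **The model currents of degree `c ≥ 0`**: `T = c · dd^c log ‖z‖_∞` (sup norm on `ℂ^{N+1}`),
with cone potential `V(v) = c log ‖v‖_∞` (`-∞` at `0`), plurisubharmonic by
`isPlurisubharmonicOn_mul_log_norm` and log-homogeneous of degree `c`. (With the Euclidean norm
this would be `c ω_FS`; the sup-norm version is cohomologous to it and has potential
`c log max_i |z_i|`, locally bounded on `ℂ^{N+1} ∖ {0}`.) Shows that `ClosedPositiveOneOneCurrent N`
is inhabited in every degree. [folklore] -/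
def logSupNorm (N : ℕ) (c : ℝ) (hc : 0 ≤ c) : ClosedPositiveOneOneCurrent N where
  pot := fun v ↦ if v = 0 then (⊥ : EReal) else ((c * Real.log ‖v‖ : ℝ) : EReal)
  degree := c
  degree_nonneg := hc
  isPlurisubharmonicOn_pot := isPlurisubharmonicOn_mul_log_norm hc
  isLogHomogeneous_pot := fun a v ha hv ↦ by
    simp only [smul_ne_zero ha hv, hv, if_false, ← EReal.coe_add, EReal.coe_eq_coe_iff,
      norm_smul, Real.log_mul (norm_ne_zero_iff.2 ha) (norm_ne_zero_iff.2 hv)]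
    ring
  frequently_ne_bot := fun v hv ↦ by
    have : ∀ᶠ y in 𝓝 v, y ≠ (0 : Fin (N + 1) → ℂ) := isOpen_ne.eventually_mem hv
    exact (this.mono fun y hy ↦ by simp only [hy, if_false]; exact EReal.coe_ne_bot _).frequently

/-- The potential of `logSupNorm` off the vertex. [folklore] -/
theorem logSupNorm_pot_of_ne_zero {c : ℝ} (hc : 0 ≤ c) {v : Fin (N + 1) → ℂ} (hv : v ≠ 0) :
    (logSupNorm N c hc).pot v = ((c * Real.log ‖v‖ : ℝ) : EReal) := by
  simp [logSupNorm, hv]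

/-- `logSupNorm N c` has degree `c`: every degree `c ≥ 0` occurs. [folklore] -/
@[simp] theorem degree_logSupNorm {c : ℝ} (hc : 0 ≤ c) : (logSupNorm N c hc).degree = c := rfl

variable (T : ClosedPositiveOneOneCurrent N)

/-- The potential is `< +∞` off the vertex. [folklore] -/
theorem pot_lt_top {v : Fin (N + 1) → ℂ} (hv : v ≠ 0) : T.pot v < ⊤ :=
  T.isPlurisubharmonicOn_pot.lt_top hv

/-- Log-homogeneity, restated: `V(a v) = V(v) + c log |a|`. [folklore] -/
theorem pot_smul {a : ℂ} (ha : a ≠ 0) {v : Fin (N + 1) → ℂ} (hv : v ≠ 0) :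
    T.pot (a • v) = T.pot v + ((T.degree * Real.log ‖a‖ : ℝ) : EReal) :=
  T.isLogHomogeneous_pot a v ha hv

/-- Unit scalars do not change the potential (`V` is constant on Hopf circles). [folklore] -/
theorem pot_smul_of_norm_eq_one {a : ℂ} (ha : ‖a‖ = 1) {v : Fin (N + 1) → ℂ} (hv : v ≠ 0) :
    T.pot (a • v) = T.pot v := by
  have ha0 : a ≠ 0 := fun h ↦ by simp [h] at ha
  rw [T.pot_smul ha0 hv, ha, Real.log_one, mul_zero, EReal.coe_zero, add_zero]

/-! ### Lelong numbers of a current on `ℙᴺ` -/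

/-- The **Lelong number** `ν(T, x)` of `T` at `x ∈ ℙᴺ(ℂ)`: the Lelong number at the representative
`x.rep ∈ ℂ^{N+1} ∖ {0}` of the cone potential `V` (`= ν` of the local potential of `T` at `x`,
as `V - φ ∘ chart` is pluriharmonic near `x.rep`; independent of the representative by
log-homogeneity, `lelongNumber_mk`). [cite: DangDoPham2025, §2.1 (definition of ν(φ, x₀))] -/
def lelongNumber (x : ℙ ℂ (Fin (N + 1) → ℂ)) : ℝ :=
  Pluripotential.lelongNumber T.pot x.rep

/-- `ν(T, x) ≥ 0`. [cite: DangDoPham2025, §2.1] -/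
theorem lelongNumber_nonneg (x : ℙ ℂ (Fin (N + 1) → ℂ)) : 0 ≤ T.lelongNumber x :=
  Pluripotential.lelongNumber_nonneg _ _

/-- **Well-definedness**: `ν(T, [v]) = ν(V, v)` for every representative `v ≠ 0` (the chosen
representative `[v].rep` is a unit multiple of `v`, and `ν(V, ·)` is constant on `ℂˣ • v` by
log-homogeneity). [folklore] -/
theorem lelongNumber_mk {v : Fin (N + 1) → ℂ} (hv : v ≠ 0) :
    T.lelongNumber (Projectivization.mk ℂ v hv) = Pluripotential.lelongNumber T.pot v := by
  obtain ⟨a, ha⟩ := Projectivization.exists_smul_eq_mk_rep ℂ v hv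
  rw [lelongNumber, ← ha, Units.smul_def]
  exact T.isLogHomogeneous_pot.lelongNumber_smul a.ne_zero hv

/-- The model currents have ZERO Lelong numbers everywhere (their potential `c log ‖z‖_∞` is finite
and continuous off the vertex) — as generic members of their class should. [folklore] -/
theorem lelongNumber_logSupNorm {c : ℝ} (hc : 0 ≤ c) (x : ℙ ℂ (Fin (N + 1) → ℂ)) :
    (logSupNorm N c hc).lelongNumber x = 0 := by
  have hv : x.rep ≠ 0 := x.rep_nonzero
  refine lelongNumber_eq_zero_of_continuousAt (f := fun y ↦ c * Real.log ‖y‖) ?_ ?_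
  · exact continuousAt_const.mul ((continuous_norm.continuousAt).log (norm_ne_zero_iff.2 hv))
  · have : ∀ᶠ y in 𝓝 x.rep, y ≠ (0 : Fin (N + 1) → ℂ) := isOpen_ne.eventually_mem hv
    filter_upwards [nhdsWithin_le_nhds this] with y hy
    exact logSupNorm_pot_of_ne_zero hc hy

/-- The **Lelong upper level set** `E_c(T) = {x ∈ ℙᴺ | ν(T, x) ≥ c}`.
[cite: Siu1974, Main Theorem (the sets E_c)] -/
def lelongUpperLevelSet (c : ℝ) : Set (ℙ ℂ (Fin (N + 1) → ℂ)) :=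
  {x | c ≤ T.lelongNumber x}

/-- Unfolding of `lelongUpperLevelSet`. [folklore] -/
@[simp] theorem mem_lelongUpperLevelSet_iff (c : ℝ) (x : ℙ ℂ (Fin (N + 1) → ℂ)) :
    x ∈ T.lelongUpperLevelSet c ↔ c ≤ T.lelongNumber x := Iff.rfl

/-- `E_c(T) = ℙᴺ` for `c ≤ 0`. [folklore] -/
theorem lelongUpperLevelSet_eq_univ {c : ℝ} (hc : c ≤ 0) : T.lelongUpperLevelSet c = univ :=
  eq_univ_of_forall fun x ↦ hc.trans (T.lelongNumber_nonneg x)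

/-- The upper level sets decrease as the level increases: `E_{c'}(T) ⊆ E_c(T)` for `c ≤ c'`.
[folklore] -/
theorem lelongUpperLevelSet_antitone : Antitone T.lelongUpperLevelSet :=
  fun _ _ hcc' _ hx ↦ hcc'.trans hx

/-- The **generic Lelong number** of `T` along a subset `Z ⊆ ℙᴺ`: `ν(T, Z) = inf_{x ∈ Z} ν(T, x)`
(for an irreducible analytic `Z` this infimum is attained and is the value of `ν(T, ·)` at the
very general point of `Z`, by Siu's theorem; Demailly: `ν_{p,k} = min_{x ∈ Z_{p,k}} ν(T, x)`).
Junk `0` for `Z = ∅` (`Real.sInf ∅`). [cite: Siu1974, Main Theorem] -/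
def genericLelongNumber (Z : Set (ℙ ℂ (Fin (N + 1) → ℂ))) : ℝ :=
  sInf (T.lelongNumber '' Z)

/-- `ν(T, Z) ≥ 0`. [folklore] -/
theorem genericLelongNumber_nonneg (Z : Set (ℙ ℂ (Fin (N + 1) → ℂ))) :
    0 ≤ T.genericLelongNumber Z :=
  Real.sInf_nonneg (by rintro _ ⟨x, -, rfl⟩; exact T.lelongNumber_nonneg x)

/-- `ν(T, Z) ≤ ν(T, x)` for `x ∈ Z`. [folklore] -/
theorem genericLelongNumber_le {Z : Set (ℙ ℂ (Fin (N + 1) → ℂ))} {x : ℙ ℂ (Fin (N + 1) → ℂ)}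
    (hx : x ∈ Z) : T.genericLelongNumber Z ≤ T.lelongNumber x :=
  csInf_le ⟨0, by rintro _ ⟨y, -, rfl⟩; exact T.lelongNumber_nonneg y⟩ ⟨x, hx, rfl⟩

/-- The generic Lelong number can only drop when the set grows: `ν(T, Z') ≤ ν(T, Z)` for
`∅ ≠ Z ⊆ Z'`. [folklore] -/
theorem genericLelongNumber_anti {Z Z' : Set (ℙ ℂ (Fin (N + 1) → ℂ))} (hZ : Z.Nonempty)
    (hZZ' : Z ⊆ Z') : T.genericLelongNumber Z' ≤ T.genericLelongNumber Z :=
  csInf_le_csInf ⟨0, by rintro _ ⟨y, -, rfl⟩; exact T.lelongNumber_nonneg y⟩ (hZ.image _)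
    (image_mono hZZ')

/-- Every point of `Z` at which `ν(T, ·) ≥ c` fails bounds the generic number: if `ν(T, Z) ≥ c`
then `Z ⊆ E_c(T)`. [folklore] -/
theorem subset_lelongUpperLevelSet_of_le_genericLelongNumber {Z : Set (ℙ ℂ (Fin (N + 1) → ℂ))}
    {c : ℝ} (hc : c ≤ T.genericLelongNumber Z) : Z ⊆ T.lelongUpperLevelSet c :=
  fun _ hx ↦ hc.trans (T.genericLelongNumber_le hx)

/-! ### The regular locus and the regular part of the Monge–Ampère masses -/

/-- The chart potential `g(w) = V(1, w)` of `T` on the affine chart `ℂᴺ = {z₀ ≠ 0}` (a local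
potential: `T = dd^c g` there), as a real function (`EReal.toReal`, junk `0` at the poles
`V = -∞`). [folklore] -/
def chartPotential (w : Fin N → ℂ) : ℝ :=
  (T.pot (chartVec w)).toReal

/-- The **regular locus** of `T` in the chart `{z₀ ≠ 0}`: the (open) set of `w ∈ ℂᴺ` at which
the chart potential `g` is `C²` (as a real function of `2N` real variables). Poles are excluded
automatically (`g → -∞` at a pole of the u.s.c. `V`, so `g` is not even continuous there). On this
set `T` is the continuous positive `(1,1)`-form `dd^c g`. [folklore] -/
def regularLocus : Set (Fin N → ℂ) :=
  {w | ContDiffAt ℝ 2 T.chartPotential w}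

/-- Unfolding of `regularLocus`. [folklore] -/
@[simp] theorem mem_regularLocus_iff (w : Fin N → ℂ) :
    w ∈ T.regularLocus ↔ ContDiffAt ℝ 2 T.chartPotential w := Iff.rfl

/-- The regular locus is open (`C²` at a point ⟹ `C²` nearby, for finite differentiability
order). [folklore] -/
theorem isOpen_regularLocus : IsOpen T.regularLocus := by
  rw [isOpen_iff_mem_nhds]
  intro w hw
  exact (show ContDiffAt ℝ 2 T.chartPotential w from hw).eventually (by simp)

/-- The regular locus is (Borel) measurable. [folklore] -/
theorem measurableSet_regularLocus : MeasurableSet T.regularLocus :=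
  T.isOpen_regularLocus.measurableSet

/-- The affine chart `w ↦ (1, w)` of the cone is smooth (it is affine). [folklore] -/
theorem contDiff_chartVec : ContDiff ℝ ∞ (chartVec : (Fin N → ℂ) → (Fin (N + 1) → ℂ)) := by
  rw [contDiff_pi]
  intro i
  refine Fin.cases ?_ (fun j ↦ ?_) i
  · have h : (fun w : Fin N → ℂ ↦ chartVec w 0) = fun _ ↦ (1 : ℂ) := by
      funext w; simp [chartVec]
    rw [h]; exact contDiff_const
  · have h : (fun w : Fin N → ℂ ↦ chartVec w j.succ) = fun w ↦ w j := by
      funext w; simp [chartVec]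
    rw [h]; exact contDiff_apply ℝ ℂ j

/-- The **regular Monge–Ampère mass of order `j`**:
`regularMass j = ∫_{Reg(T)} (dd^c g)^j ∧ ω_FS^{N-j} ∈ [0, ∞]`, the lower Lebesgue integral over
the regular locus (in the full-measure chart `{z₀ ≠ 0}`) of the classical density
`heightDensity j g` of `T^j ∧ ω_FS^{N-j}` (non-negative there since `dd^c g ≥ 0`). By plurifine
locality of the non-pluripolar product (BEGZ Def. 1.1, Prop. 1.4) and Bedford–Taylor for `C²`
potentials, `1_{Reg} ⟨T^j⟩ = 1_{Reg} (dd^c g)^j`, so this is the mass of `⟨T^j⟩ ∧ ω^{N-j}` carried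
by the regular locus — a lower bound for the total non-pluripolar mass, equal to it for currents
regular off a closed complete pluripolar set (BEGZ §1.2). For `j = 0` it is the Fubini–Study
volume of `Reg(T)` (`≤ 1`). [cite: BoucksomEtAl2010, Def. 1.1, Def. 1.2 and Prop. 1.4] -/
def regularMass (j : ℕ) : ℝ≥0∞ :=
  ∫⁻ w in T.regularLocus, ENNReal.ofReal (heightDensity j T.chartPotential w)

/-- Unfolding of `regularMass`. [folklore] -/
theorem regularMass_def (j : ℕ) : T.regularMass j =
    ∫⁻ w in T.regularLocus, ENNReal.ofReal (heightDensity j T.chartPotential w) := rfl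

/-- The chart potential of the zero current is `0`. [folklore] -/
theorem chartPotential_zero : (zero N).chartPotential = fun _ ↦ 0 := by
  funext w
  simp [chartPotential, zero]

/-- The complex Hessian of the zero function vanishes. [folklore] -/
theorem leviMatrix_zero_fun (w : Fin N → ℂ) :
    Literature.AlgebraicGeometry.HodgeTheory.BiextensionHeight.leviMatrix (fun _ ↦ (0 : ℝ)) w = 0 := by
  ext p q
  have h0 : (fun _ : Fin N → ℂ ↦ (0 : ℝ)) = 0 := rfl
  simp [Literature.AlgebraicGeometry.HodgeTheory.BiextensionHeight.leviMatrix, h0]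

/-- The density of `(dd^c 0)^j ∧ ω_FS^{N-j}` vanishes for `j ≥ 1` (`det` of a constant matrix
polynomial has no `s^j`-coefficient). [folklore] -/
theorem heightDensity_zero_fun {j : ℕ} (hj : 1 ≤ j) (w : Fin N → ℂ) :
    heightDensity j (fun _ ↦ (0 : ℝ)) w = 0 := by
  have hdet : ((Literature.AlgebraicGeometry.HodgeTheory.BiextensionHeight.leviMatrix
      Literature.AlgebraicGeometry.HodgeTheory.BiextensionHeight.fsPotential w).map
        (Polynomial.C : ℂ → Polynomial ℂ)).det.coeff j = 0 := by
    rw [← RingHom.mapMatrix_apply, ← RingHom.map_det, Polynomial.coeff_C, if_neg (by omega)]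
  simp [heightDensity, leviMatrix_zero_fun, hdet]

/-- The zero current has zero regular masses in every order `j ≥ 1`. [folklore] -/
theorem regularMass_zero {j : ℕ} (hj : 1 ≤ j) : (zero N).regularMass j = 0 := by
  simp [regularMass, chartPotential_zero, heightDensity_zero_fun hj]

/-- `T` is **regular off** `A ⊆ ℙᴺ(ℂ)`: `A` is closed, its punctured affine cone is complete
pluripolar in `ℂ^{N+1} ∖ {0}` (e.g. `A` algebraic: `A = {F₁ = ⋯ = F_k = 0}`,
`ψ = log Σ |F_i|`), and the potential `V` is `C²` at every point of the cone over `ℙᴺ ∖ A`. Then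
`T` has *small unbounded locus* in the sense of BEGZ Def. 1.2 (potentials locally bounded — here
even `C²` — outside the closed complete pluripolar `A`), and `⟨T^j⟩` is the trivial extension of
the smooth form `T^j` from `ℙᴺ ∖ A` (BEGZ §1.2). The route's height currents (`A` = dual variety)
and currents with analytic singularities along `A` are of this kind.
[cite: BoucksomEtAl2010, Def. 1.2] -/
def IsRegularOff (A : Set (ℙ ℂ (Fin (N + 1) → ℂ))) : Prop :=
  IsClosed A ∧
    IsCompletePluripolarIn (Projectivization.conePreimage A \ {0}) ({0}ᶜ : Set (Fin (N + 1) → ℂ)) ∧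
    ∀ v : Fin (N + 1) → ℂ, v ∉ Projectivization.conePreimage A →
      ContDiffAt ℝ 2 (fun u ↦ (T.pot u).toReal) v

/-- If `T` is regular off `A`, every chart point lying over `ℙᴺ ∖ A` belongs to the regular locus
(so `regularMass` integrates at least over the chart part of `ℙᴺ ∖ A`, cf.
`BiextensionHeight.chartDomain`). [folklore] -/
theorem IsRegularOff.mem_regularLocus {T : ClosedPositiveOneOneCurrent N}
    {A : Set (ℙ ℂ (Fin (N + 1) → ℂ))} (hA : T.IsRegularOff A) {w : Fin N → ℂ}
    (hw : chartVec w ∉ Projectivization.conePreimage A) : w ∈ T.regularLocus :=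
  (hA.2.2 _ hw).comp w (contDiff_chartVec.contDiffAt.of_le (by norm_cast))

end ClosedPositiveOneOneCurrent

/-! ### Non-pluripolar Monge–Ampère masses (hypothesis structure) -/

/-- **The non-pluripolar Monge–Ampère masses of a closed positive `(1,1)`-current `T` on `ℙᴺ(ℂ)`**
(hypothesis structure; see the module docstring for the junk analysis). DATA: `mass j ∈ [0, ∞]`,
intended value `∫_{ℙᴺ} ⟨T^j⟩ ∧ ω_FS^{N-j}` for `1 ≤ j ≤ N`, where `⟨T^j⟩` is the non-pluripolar
product of BEGZ (Def. 1.1: `1_{{φ>-k}} ⟨T^j⟩ = 1_{{φ>-k}} (c ω + dd^c max(φ,-k))^j`, increasing in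
`k`, no mass on pluripolar sets; well defined and closed on the compact Kähler `ℙᴺ`, Prop. 1.6,
Thm. 1.8). FIELDS: the printed theorems tying these numbers to the honest objects of this file.
[cite: BoucksomEtAl2010, Def. 1.1, Prop. 1.4, Prop. 1.6, §1.2, Prop. 1.20 and Cor. 2.15]
[cite: GuedjZeriahi2007, Cor. 1.8] -/
structure NonPluripolarMongeAmpereMass (T : ClosedPositiveOneOneCurrent N) where
  /-- `mass j = ∫_{ℙᴺ} ⟨T^j⟩ ∧ ω_FS^{N-j} ∈ [0, ∞]` (meaningful for `1 ≤ j ≤ N`).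
  [cite: BoucksomEtAl2010, Def. 1.1 and Prop. 1.6] -/
  mass : ℕ → ℝ≥0∞
  /-- LOCALITY: the non-pluripolar product is local in the plurifine (a fortiori the usual)
  topology and agrees with the classical form where the potential is `C²`, so the mass carried by
  the regular locus is a lower bound: `∫_{Reg T} T^j ∧ ω^{N-j} ≤ ∫ ⟨T^j⟩ ∧ ω^{N-j}`.
  [cite: BoucksomEtAl2010, Def. 1.1 and Prop. 1.4] -/
  regularMass_le_mass : ∀ j, 1 ≤ j → j ≤ N → T.regularMass j ≤ mass j
  /-- BEGZ Prop. 1.20: `{⟨T₁ ∧ ⋯ ∧ T_p⟩} ≤ ⟨α₁ ⋯ α_p⟩`; on `ℙᴺ` with `T_i = T ∈ c{ω}` (Kähler or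
  zero class, so `⟨α^j⟩ = α^j`) and paired with `ω^{N-j}`: `∫ ⟨T^j⟩ ∧ ω^{N-j} ≤ c^j`.
  [cite: BoucksomEtAl2010, Prop. 1.20] -/
  mass_le_degree_pow : ∀ j, 1 ≤ j → j ≤ N → mass j ≤ ENNReal.ofReal (T.degree ^ j)
  /-- SMALL UNBOUNDED LOCUS: if `T` is `C²` off a closed complete pluripolar `A` then `⟨T^j⟩` is the
  trivial extension of the smooth form `T^j` on `ℙᴺ ∖ A`, whose mass is the regular mass (`A` and
  `{z₀ = 0}` are Lebesgue-null). [cite: BoucksomEtAl2010, Def. 1.2 (and the paragraph following it)] -/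
  mass_eq_regularMass : ∀ A, T.IsRegularOff A → ∀ j, 1 ≤ j → j ≤ N → mass j = T.regularMass j
  /-- FULL MASS PROPAGATES DOWN: if `∫ ⟨T^N⟩ = c^N` with `c > 0` then `∫ ⟨T^j⟩ ∧ ω^{N-j} = c^j` for
  all `1 ≤ j ≤ N` (BEGZ Cor. 2.15 with `T₁ = ⋯ = T_j = T/c`, `T_{j+1} = ⋯ = T_N = ω`, all of full
  Monge–Ampère mass in the class `{ω}`, `⟨{ω}^N⟩ = 1`). [cite: BoucksomEtAl2010, Cor. 2.15] -/
  mass_eq_of_mass_top_eq : mass N = ENNReal.ofReal (T.degree ^ N) → 0 < T.degree →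
    ∀ j, 1 ≤ j → j ≤ N → mass j = ENNReal.ofReal (T.degree ^ j)
  /-- FULL MASS ⟹ ZERO LELONG NUMBERS: if `∫ ⟨T^N⟩ = c^N`, `c > 0` (i.e. `φ = (V - c log‖z‖)/c`
  lies in the class `𝓔(ℙᴺ, ω)` of Guedj–Zeriahi), then `ν(T, x) = 0` at every point.
  [cite: GuedjZeriahi2007, Cor. 1.8] -/
  lelongNumber_eq_zero_of_mass_top_eq : mass N = ENNReal.ofReal (T.degree ^ N) → 0 < T.degree →
    ∀ x, T.lelongNumber x = 0

namespace NonPluripolarMongeAmpereMass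

variable {T : ClosedPositiveOneOneCurrent N} (M : NonPluripolarMongeAmpereMass T)

/-- `T` has **full Monge–Ampère mass**: `∫_{ℙᴺ} ⟨T^N⟩ = (deg T)^N` (`= vol(c{ω})`); a predicate
on the mass package `M'` (not a named fact). [cite: BoucksomEtAl2010, Def. 1.21] -/
def HasFullMass (M' : NonPluripolarMongeAmpereMass T) : Prop :=
  M'.mass N = ENNReal.ofReal (T.degree ^ N)

/-- The masses are finite (`1 ≤ j ≤ N`). [cite: BoucksomEtAl2010, Prop. 1.6 and Prop. 1.20] -/
theorem mass_lt_top {j : ℕ} (h1 : 1 ≤ j) (hN : j ≤ N) : M.mass j < ⊤ :=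
  (M.mass_le_degree_pow j h1 hN).trans_lt ENNReal.ofReal_lt_top

/-- `M_j = ∫ ⟨T^j⟩ ∧ ω^{N-j}` as a real number. [cite: BoucksomEtAl2010, Def. 1.1] -/
def massReal (j : ℕ) : ℝ :=
  (M.mass j).toReal

/-- `0 ≤ M_j`. [cite: BoucksomEtAl2010, Def. 1.1] -/
theorem massReal_nonneg (j : ℕ) : 0 ≤ M.massReal j := ENNReal.toReal_nonneg

/-- **`M_j ≤ (deg T)^j`** for `1 ≤ j ≤ N` (real form). [cite: BoucksomEtAl2010, Prop. 1.20] -/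
theorem massReal_le_degree_pow {j : ℕ} (h1 : 1 ≤ j) (hN : j ≤ N) :
    M.massReal j ≤ T.degree ^ j :=
  ENNReal.toReal_le_of_le_ofReal (pow_nonneg T.degree_nonneg j) (M.mass_le_degree_pow j h1 hN)

/-- The **mass defect** `(deg T)^j - M_j` is non-negative. [cite: BoucksomEtAl2010, Prop. 1.20] -/
theorem sub_massReal_nonneg {j : ℕ} (h1 : 1 ≤ j) (hN : j ≤ N) :
    0 ≤ T.degree ^ j - M.massReal j :=
  sub_nonneg.2 (M.massReal_le_degree_pow h1 hN)

include M in
/-- The regular mass is bounded by `(deg T)^j` (through `mass j`).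
[cite: BoucksomEtAl2010, Prop. 1.4 and Prop. 1.20] -/
theorem regularMass_le_degree_pow {j : ℕ} (h1 : 1 ≤ j) (hN : j ≤ N) :
    T.regularMass j ≤ ENNReal.ofReal (T.degree ^ j) :=
  (M.regularMass_le_mass j h1 hN).trans (M.mass_le_degree_pow j h1 hN)

/-- For a current regular off a closed complete pluripolar set the masses ARE the regular masses
(real form). [cite: BoucksomEtAl2010, Def. 1.2] -/
theorem massReal_eq_toReal_regularMass {A : Set (ℙ ℂ (Fin (N + 1) → ℂ))} (hA : T.IsRegularOff A)
    {j : ℕ} (h1 : 1 ≤ j) (hN : j ≤ N) : M.massReal j = (T.regularMass j).toReal := by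
  rw [massReal, M.mass_eq_regularMass A hA j h1 hN]

/-- Full mass and positive degree force all Lelong numbers to vanish; contrapositively a point of
positive Lelong number is a MASS DEFECT `M_N < (deg T)^N`. [cite: GuedjZeriahi2007, Cor. 1.8] -/
theorem massReal_lt_degree_pow_of_lelongNumber_pos (hdeg : 0 < T.degree)
    {x : ℙ ℂ (Fin (N + 1) → ℂ)} (hx : 0 < T.lelongNumber x) (hN : 1 ≤ N) :
    M.massReal N < T.degree ^ N := by
  refine lt_of_le_of_ne (M.massReal_le_degree_pow hN le_rfl) fun heq ↦ ?_
  have hfull : M.mass N = ENNReal.ofReal (T.degree ^ N) := by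
    rw [← heq, massReal, ENNReal.ofReal_toReal (M.mass_lt_top hN le_rfl).ne]
  exact hx.ne' (M.lelongNumber_eq_zero_of_mass_top_eq hfull hdeg x)

/-- NON-VACUITY / consistency in the trivial case: the zero current (`deg = 0`) carries the zero
masses (`⟨0^j⟩ = 0`); all fields hold (the full-mass fields are vacuous as `deg = 0`). [folklore] -/
def ofZero (N : ℕ) : NonPluripolarMongeAmpereMass (ClosedPositiveOneOneCurrent.zero N) where
  mass := fun _ ↦ 0
  regularMass_le_mass := fun _ h1 _ ↦ (ClosedPositiveOneOneCurrent.regularMass_zero h1).le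
  mass_le_degree_pow := fun _ _ _ ↦ zero_le
  mass_eq_regularMass := fun _ _ _ h1 _ ↦ (ClosedPositiveOneOneCurrent.regularMass_zero h1).symm
  mass_eq_of_mass_top_eq := fun _ hdeg ↦ absurd hdeg (lt_irrefl _)
  lelongNumber_eq_zero_of_mass_top_eq := fun _ hdeg ↦ absurd hdeg (lt_irrefl _)

end NonPluripolarMongeAmpereMass

/-! ### Named facts on the honest objects -/

/-- **Siu's theorem** (on `ℙᴺ`): for a closed positive `(1,1)`-current `T` on `ℙᴺ(ℂ)` and `c > 0`
the Lelong upper level set `E_c(T) = {x | ν(T, x) ≥ c}` is a (closed) analytic subset of the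
complex manifold `ℙᴺ(ℂ)` (standard affine atlas of `ProjectiveSpace.lean`; hence algebraic by
Chow). Siu 1974 proves it for closed positive `(p,p)`-currents on complex manifolds. A named fact
(statement only). [cite: Siu1974, Main Theorem] -/
def Siu1974_isAnalyticSet_lelongUpperLevelSet : Prop :=
  ∀ (N : ℕ) (T : ClosedPositiveOneOneCurrent N) (c : ℝ), 0 < c →
    Literature.Geometry.Kaehler.IsAnalyticSet 𝓘(ℂ, Fin N → ℂ) (T.lelongUpperLevelSet c)

/-- **BEGZ mass bound, regular part** (honest-object form of `0 ≤ M_j ≤ (deg T)^j`): for every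
closed positive `(1,1)`-current `T` on `ℙᴺ(ℂ)` and `1 ≤ j ≤ N`,
`∫_{Reg T} T^j ∧ ω_FS^{N-j} ≤ (deg T)^j`. This is Prop. 1.20 of BEGZ
(`{⟨T^j⟩}·{ω}^{N-j} ≤ ⟨(c{ω})^j⟩·{ω}^{N-j} = c^j`) combined with the locality of the
non-pluripolar product (Def. 1.1, Prop. 1.4: on the open regular locus `⟨T^j⟩` is the classical
form), i.e. a consequence weaker than the printed statement. A named fact (statement only).
[cite: BoucksomEtAl2010, Prop. 1.20 (with Def. 1.1 and Prop. 1.4)] -/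
def BoucksomEtAl2010_regularMass_le_degree_pow : Prop :=
  ∀ (N : ℕ) (T : ClosedPositiveOneOneCurrent N) (j : ℕ), 1 ≤ j → j ≤ N →
    T.regularMass j ≤ ENNReal.ofReal (T.degree ^ j)

/-- **Full regular mass ⟹ zero Lelong numbers** (honest-object form of Guedj–Zeriahi, Cor. 1.8):
if `deg T = c > 0` and already the regular part has full top-degree mass,
`∫_{Reg T} T^N = c^N` (then `∫⟨T^N⟩ = c^N` by locality and Prop. 1.20, i.e. `T/c ∈ 𝓔(ℙᴺ, ω)`),
then `ν(T, x) = 0` for every `x ∈ ℙᴺ`. A named fact (statement only).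
[cite: GuedjZeriahi2007, Cor. 1.8] -/
def GuedjZeriahi2007_lelongNumber_eq_zero_of_regularMass_eq : Prop :=
  ∀ (N : ℕ) (T : ClosedPositiveOneOneCurrent N), 0 < T.degree →
    T.regularMass N = ENNReal.ofReal (T.degree ^ N) → ∀ x, T.lelongNumber x = 0

end Literature.Analysis.Pluripotential

end
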